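import Summits.Ventures.CertifiedQuantumChemistry.Rows.ExactLDLDecision
import HarnessLib

/-!
# Ventures/CertifiedQuantumChemistry — Rows/BlockScatterPSD.lean: positive semidefiniteness ASSEMBLED FROM
# DIAGONAL BLOCKS (a matrix that is the scatter-sum of its own diagonal blocks is PSD once every block is), with
# the kernel-facing corollary: per-block runs of the exact `LDLᵀ` decision procedure on RATIONAL data

HONEST FRAMING (verbatim): certified bounds for a stated model Hamiltonian in a stated basis; not a
claim about the real molecule beyond that model. Nothing in this file asserts a value, a row or a claim
node about anything; it types a CERTIFICATE FORMAT used by the cell's kernel certificates.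

Seat rdm-B (gen 41), zero compute. Companion of `Rows/ExactLDLDecision.lean` (gen 31: `ExactLDL.ldlAccept n M = true ↔
M ⪰ 0` for Hermitian `M` over a linearly ordered field; `ldlAccept_iff_posSemidef_real`). The strict-gap certificates of
`Certificates/HubbardRingL4U*DQGGap*.lean` (gen 40) run that procedure on the FULL `64 × 64` matrices `Γ`, `Q(γ, Γ)`,
`G(γ, Γ)` of a candidate pair — about `64³/3` exact rational operations with growing denominators each, two to four
minutes of kernel time per matrix, hence one matrix per file. But these matrices are BLOCK DIAGONAL by `S_z`
conservation (pair blocks `↑↑ | ↑↓,↓↑ | ↓↓` of sizes `16 | 32 | 16` for `Γ` and `Q`; particle–hole blocks `S_z = 0 | +1 | −1`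
of sizes `32 | 16 | 16` for `G`), and finer still under lattice symmetries. This file types the obvious saving ONCE,
for any index type and any number of blocks, in a form the kernel can evaluate on literal tables:

* §1 `BlockScatter.sel`, `BlockScatter.scatter`: for block data given by two plain tables `lab pos : n → ℕ` (block
  label and position inside the block — NO consistency between them is assumed anywhere) the scatter of an
  `m × m` matrix `X` into block `b` is the congruence `selᴴ · X · sel` by the `0/1` selection matrix
  (`scatter_eq_conjTranspose_mul_mul`), hence PSD whenever `X` is (`posSemidef_scatter`, Mathlib's
  `PosSemidef.conjTranspose_mul_mul_same`); a matrix that EQUALS a finite sum of scatters of PSD blocks is PSD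
  (`posSemidef_of_eq_sum_scatter`; the equality is the only link between the tables and the matrix, and for literal
  data it is decided by the kernel entrywise). Over any star-ordered commutative ring.
* §2 the kernel-facing corollary for RATIONAL data (`posSemidef_real_of_blocks`): if every diagonal block
  `M.submatrix (e b) (e b)` (any enumerations `e b : Fin (sz b) → Fin N`) is symmetric and ACCEPTED by
  `ExactLDL.ldlAccept`, and `M` is entrywise the scatter-sum of these blocks, then the REAL matrix `M.map Rat.cast` is
  positive semidefinite — `Σ_b (sz b)³/3` operations instead of `N³/3` (for the `L = 4` pair matrices `2·16³ + 32³`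
  vs `64³`: a factor `6.4`; for `L = 6`, `144 × 144` with blocks `36 | 72 | 36`: the difference between infeasible
  and feasible on the farm). `scatter_map` moves the format along ring homomorphisms.

Not to be confused with the typer's `Rows/SymmetryBlocks.lean` (orbit blocking of INTEGER Gram certificates `ddCheckP` under sign
symmetries, for the `E₀` lower rows): here the blocks are plain index subsets and the verdicts are `ExactLDL` runs.
§3 (appended gen 41): the SIGNED variant `selS` / `scatterS` (sign table `sgn : n → R`, trivial star) for the antisymmetric
pair blocks of fermionic 2-RDM conditions (`Γ_{(ij),(kl)} = s_{ij} s_{kl} X_{{ij},{kl}}`), same three statements.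
0 `sorry`; four `def`s (the plain and signed selection matrices and scatters), no `def … : Prop`, standard axioms. References
(docstring-only): R. A. Horn, C. R. Johnson, Matrix Analysis (2nd ed.) Obs. 7.1.8 (congruence preserves
semidefiniteness), §7.1 (direct sums). Mathlib: `Matrix.PosSemidef.conjTranspose_mul_mul_same`, `Matrix.posSemidef_sum`.
-/

namespace Summit.Ventures.CertifiedQuantumChemistry

namespace BlockScatter

open Matrix Finset

/-! ## §1 Scatter of a block = congruence by a selection matrix; scatter-sums of PSD blocks are PSD -/

section Generic

variable {R : Type*} [CommRing R]
variable {n : Type*}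

variable (R) in
/-- The `0/1` selection matrix of block `b`: row `a` picks the indices `i` with label `b` and position `a`
(tables `lab`, `pos : n → ℕ`; nothing is assumed about them; the scalar ring is explicit). -/
def sel (m : ℕ) (lab pos : n → ℕ) (b : ℕ) : Matrix (Fin m) n R :=
  Matrix.of fun a i => if lab i = b ∧ pos i = (a : ℕ) then 1 else 0

/-- The scatter of an `m × m` block `X` into the indices of block `b`: entry `(i, j)` is `X (pos i) (pos j)` when
both `i` and `j` carry label `b` and positions `< m`, and `0` otherwise. -/
def scatter (m : ℕ) (lab pos : n → ℕ) (b : ℕ) (X : Matrix (Fin m) (Fin m) R) : Matrix n n R :=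
  Matrix.of fun i j =>
    if h : lab i = b ∧ lab j = b ∧ pos i < m ∧ pos j < m then X ⟨pos i, h.2.2.1⟩ ⟨pos j, h.2.2.2⟩ else 0

/-- Entries of the scatter (definitional unfolding). -/
theorem scatter_apply (m : ℕ) (lab pos : n → ℕ) (b : ℕ) (X : Matrix (Fin m) (Fin m) R) (i j : n) :
    scatter m lab pos b X i j =
      if h : lab i = b ∧ lab j = b ∧ pos i < m ∧ pos j < m then X ⟨pos i, h.2.2.1⟩ ⟨pos j, h.2.2.2⟩ else 0 :=
  rfl

/-- Scatter commutes with any entrywise map fixing `0` (it only copies entries of the block or writes `0`). -/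
theorem scatter_map {S : Type*} [CommRing S] (f : R → S) (hf : f 0 = 0) (m : ℕ) (lab pos : n → ℕ) (b : ℕ)
    (X : Matrix (Fin m) (Fin m) R) :
    (scatter m lab pos b X).map f = scatter m lab pos b (X.map f) := by
  ext i j
  simp only [map_apply, scatter_apply]
  split_ifs <;> simp [hf]

/-- A sum over `Fin m` of terms supported where the value equals a fixed `p < m` collapses to one term. -/
theorem sum_ite_eq_fin {m : ℕ} (p : ℕ) (hp : p < m) (g : Fin m → R) :
    ∑ a : Fin m, (if p = (a : ℕ) then g a else 0) = g ⟨p, hp⟩ := by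
  rw [Finset.sum_eq_single ⟨p, hp⟩]
  · simp
  · intro a _ ha
    have : p ≠ (a : ℕ) := fun h => ha (Fin.ext h.symm)
    simp [this]
  · intro h; exact absurd (Finset.mem_univ _) h

variable [StarRing R]

/-- **The scatter of a block is a congruence**: `scatter m lab pos b X = selᴴ · X · sel`. -/
theorem scatter_eq_conjTranspose_mul_mul (m : ℕ) (lab pos : n → ℕ) (b : ℕ)
    (X : Matrix (Fin m) (Fin m) R) :
    scatter m lab pos b X = (sel R m lab pos b).conjTranspose * X * sel R m lab pos b := by
  ext i j
  simp only [scatter_apply, Matrix.mul_apply, conjTranspose_apply, sel, Matrix.of_apply]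
  have hstar : ∀ a : Fin m, star (if lab i = b ∧ pos i = (a : ℕ) then (1 : R) else 0) =
      if lab i = b ∧ pos i = (a : ℕ) then (1 : R) else 0 := fun a => by
    split_ifs <;> simp
  simp_rw [hstar]
  by_cases hi : lab i = b
  · by_cases hj : lab j = b
    · simp only [hi, hj, true_and]
      by_cases hpi : pos i < m
      · have inner : ∀ a' : Fin m, (∑ a : Fin m, (if pos i = (a : ℕ) then (1 : R) else 0) * X a a') =
            X ⟨pos i, hpi⟩ a' := fun a' => by
          rw [← sum_ite_eq_fin (R := R) (pos i) hpi (fun a => X a a')]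
          exact Finset.sum_congr rfl fun a _ => by split_ifs <;> simp
        simp_rw [inner]
        by_cases hpj : pos j < m
        · simp only [hpi, hpj, and_self, ↓reduceDIte]
          rw [← sum_ite_eq_fin (R := R) (pos j) hpj (fun a' => X ⟨pos i, hpi⟩ a')]
          exact Finset.sum_congr rfl fun a' _ => by split_ifs <;> simp
        · simp only [hpi, hpj, and_false, ↓reduceDIte]
          symm
          refine Finset.sum_eq_zero fun a' _ => ?_
          have : pos j ≠ (a' : ℕ) := fun h => hpj (h ▸ a'.isLt)
          simp [this]
      · simp only [hpi, false_and, ↓reduceDIte]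
        symm
        refine Finset.sum_eq_zero fun a' _ => ?_
        rw [Finset.sum_eq_zero fun a _ => ?_]
        · simp
        · have : pos i ≠ (a : ℕ) := fun h => hpi (h ▸ a.isLt)
          simp [this]
    · simp [hj]
  · simp [hi]

/-- **Scatters of PSD blocks are PSD** (congruence preserves semidefiniteness). -/
theorem posSemidef_scatter [PartialOrder R] [StarOrderedRing R] [Fintype n] (m : ℕ) (lab pos : n → ℕ) (b : ℕ)
    {X : Matrix (Fin m) (Fin m) R} (hX : X.PosSemidef) : (scatter m lab pos b X).PosSemidef := by
  rw [scatter_eq_conjTranspose_mul_mul]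
  exact hX.conjTranspose_mul_mul_same _

/-- **BLOCK ASSEMBLY.** A matrix that is, entry by entry, the sum over `b < k` of the scatters of PSD blocks
`X b` (sizes `sz b`) is positive semidefinite. The tables `lab`, `pos` and the blocks are arbitrary; the
entrywise equality is the whole hypothesis (decided by the kernel on literal data). -/
theorem posSemidef_of_eq_sum_scatter [PartialOrder R] [StarOrderedRing R] [Fintype n] (k : ℕ) (sz : ℕ → ℕ)
    (lab pos : n → ℕ) (X : (b : ℕ) → Matrix (Fin (sz b)) (Fin (sz b)) R) (hX : ∀ b < k, (X b).PosSemidef)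
    {M : Matrix n n R} (hM : ∀ i j, M i j = ∑ b ∈ Finset.range k, scatter (sz b) lab pos b (X b) i j) :
    M.PosSemidef := by
  have hM' : M = ∑ b ∈ Finset.range k, scatter (sz b) lab pos b (X b) := by
    ext i j; rw [hM, Matrix.sum_apply]
  rw [hM']
  exact posSemidef_sum (x := fun b => scatter (sz b) lab pos b (X b)) (Finset.range k)
    fun b hb => posSemidef_scatter _ _ _ _ (hX b (Finset.mem_range.1 hb))

end Generic

/-! ## §2 Kernel-facing corollary: rational data, per-block `LDLᵀ` verdicts, real conclusion -/

/-- **PSD OF A RATIONAL MATRIX FROM ITS DIAGONAL BLOCKS, BY THE KERNEL.** Let `M` be a rational `N × N` matrix,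
`e b : Fin (sz b) → Fin N` enumerations of `k` index blocks, `lab`/`pos` the label/position tables. If every block
`M.submatrix (e b) (e b)` is symmetric and ACCEPTED by the exact `LDLᵀ` routine, and `M` is entrywise the
scatter-sum of these blocks, then the real matrix `M.map Rat.cast` is positive semidefinite. All three hypotheses
are decidable on literal tables. -/
theorem posSemidef_real_of_blocks {N : ℕ} (k : ℕ) (M : Matrix (Fin N) (Fin N) ℚ) (sz : ℕ → ℕ)
    (lab pos : Fin N → ℕ) (e : (b : ℕ) → Fin (sz b) → Fin N)
    (hsymm : ∀ b < k, (M.submatrix (e b) (e b)).IsSymm)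
    (hacc : ∀ b < k, ExactLDL.ldlAccept (sz b) (M.submatrix (e b) (e b)) = true)
    (hsum : ∀ i j, M i j = ∑ b ∈ Finset.range k, scatter (sz b) lab pos b (M.submatrix (e b) (e b)) i j) :
    (M.map (Rat.cast : ℚ → ℝ)).PosSemidef := by
  refine posSemidef_of_eq_sum_scatter k sz lab pos (fun b => (M.submatrix (e b) (e b)).map (Rat.cast : ℚ → ℝ))
    (fun b hb => (ExactLDL.ldlAccept_iff_posSemidef_real _ (hsymm b hb)).mp (hacc b hb)) fun i j => ?_
  rw [Matrix.map_apply, hsum i j, Rat.cast_sum]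
  refine Finset.sum_congr rfl fun b _ => ?_
  rw [← scatter_map (Rat.cast : ℚ → ℝ) Rat.cast_zero, Matrix.map_apply]

/-! ## §3 Signed selections (appended, gen 41): antisymmetric pair blocks

For the pair matrices `Γ`, `Q(γ, Γ)` of a fermionic 2-RDM the diagonal `S_z` blocks are themselves CONGRUENT to
smaller blocks on UNORDERED pairs: `Γ_{(ij),(kl)} = s_{ij} s_{kl} X_{\{ij\},\{kl\}}` with signs `s_{ij} = ±1` (`0` on `i = j`).
A sign table `sgn : n → R` in the selection matrix covers this: the scatter of `X` with signs is `selSᴴ · X · selS`,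
PSD whenever `X` is, and a matrix that is entrywise a finite sum of signed scatters of PSD blocks is PSD. -/

section Signed

variable {R : Type*} [CommRing R]
variable {n : Type*}

variable (R) in
/-- Signed selection matrix of block `b`: row `a` carries `sgn i` at the indices `i` with label `b`, position `a`. -/
def selS (m : ℕ) (lab pos : n → ℕ) (sgn : n → R) (b : ℕ) : Matrix (Fin m) n R :=
  Matrix.of fun a i => if lab i = b ∧ pos i = (a : ℕ) then sgn i else 0

/-- Signed scatter of an `m × m` block `X` into block `b`: entry `(i, j)` is `sgn i · sgn j · X (pos i) (pos j)` when
both indices carry label `b` and positions `< m`, else `0` (for a star-trivial ring, e.g. `ℚ`, `ℝ`). -/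
def scatterS (m : ℕ) (lab pos : n → ℕ) (sgn : n → R) (b : ℕ) (X : Matrix (Fin m) (Fin m) R) : Matrix n n R :=
  Matrix.of fun i j =>
    if h : lab i = b ∧ lab j = b ∧ pos i < m ∧ pos j < m then sgn i * X ⟨pos i, h.2.2.1⟩ ⟨pos j, h.2.2.2⟩ * sgn j
    else 0

/-- Entries of the signed scatter (definitional unfolding). -/
theorem scatterS_apply (m : ℕ) (lab pos : n → ℕ) (sgn : n → R) (b : ℕ) (X : Matrix (Fin m) (Fin m) R) (i j : n) :
    scatterS m lab pos sgn b X i j =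
      if h : lab i = b ∧ lab j = b ∧ pos i < m ∧ pos j < m then sgn i * X ⟨pos i, h.2.2.1⟩ ⟨pos j, h.2.2.2⟩ * sgn j
      else 0 := rfl

/-- Signed scatter commutes with entrywise ring homomorphisms. -/
theorem scatterS_map {S : Type*} [CommRing S] (f : R →+* S) (m : ℕ) (lab pos : n → ℕ) (sgn : n → R) (b : ℕ)
    (X : Matrix (Fin m) (Fin m) R) :
    (scatterS m lab pos sgn b X).map f = scatterS m lab pos (fun i => f (sgn i)) b (X.map f) := by
  ext i j
  simp only [map_apply, scatterS_apply]
  split_ifs <;> simp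

variable [StarRing R] [TrivialStar R]

/-- **The signed scatter is a congruence**: `scatterS m lab pos sgn b X = selSᴴ · X · selS` (trivial star). -/
theorem scatterS_eq_conjTranspose_mul_mul (m : ℕ) (lab pos : n → ℕ) (sgn : n → R) (b : ℕ)
    (X : Matrix (Fin m) (Fin m) R) :
    scatterS m lab pos sgn b X = (selS R m lab pos sgn b).conjTranspose * X * selS R m lab pos sgn b := by
  ext i j
  simp only [scatterS_apply, Matrix.mul_apply, conjTranspose_apply, selS, Matrix.of_apply, star_trivial]
  by_cases hi : lab i = b
  · by_cases hj : lab j = b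
    · simp only [hi, hj, true_and]
      by_cases hpi : pos i < m
      · have inner : ∀ a' : Fin m, (∑ a : Fin m, (if pos i = (a : ℕ) then sgn i else 0) * X a a') =
            sgn i * X ⟨pos i, hpi⟩ a' := fun a' => by
          rw [← sum_ite_eq_fin (R := R) (pos i) hpi (fun a => sgn i * X a a')]
          exact Finset.sum_congr rfl fun a _ => by split_ifs <;> simp
        simp_rw [inner]
        by_cases hpj : pos j < m
        · simp only [hpi, hpj, and_self, ↓reduceDIte]
          rw [← sum_ite_eq_fin (R := R) (pos j) hpj (fun a' => sgn i * X ⟨pos i, hpi⟩ a' * sgn j)]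
          exact Finset.sum_congr rfl fun a' _ => by split_ifs <;> simp
        · simp only [hpi, hpj, and_false, ↓reduceDIte]
          symm
          refine Finset.sum_eq_zero fun a' _ => ?_
          have : pos j ≠ (a' : ℕ) := fun h => hpj (h ▸ a'.isLt)
          simp [this]
      · simp only [hpi, false_and, ↓reduceDIte]
        symm
        refine Finset.sum_eq_zero fun a' _ => ?_
        rw [Finset.sum_eq_zero fun a _ => ?_]
        · simp
        · have : pos i ≠ (a : ℕ) := fun h => hpi (h ▸ a.isLt)
          simp [this]
    · simp [hj]
  · simp [hi]

/-- **Signed scatters of PSD blocks are PSD.** -/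
theorem posSemidef_scatterS [PartialOrder R] [StarOrderedRing R] [Fintype n] (m : ℕ) (lab pos : n → ℕ)
    (sgn : n → R) (b : ℕ) {X : Matrix (Fin m) (Fin m) R} (hX : X.PosSemidef) :
    (scatterS m lab pos sgn b X).PosSemidef := by
  rw [scatterS_eq_conjTranspose_mul_mul]
  exact hX.conjTranspose_mul_mul_same _

/-- **SIGNED BLOCK ASSEMBLY.** A matrix that is, entry by entry, the sum over `b < k` of signed scatters of PSD blocks
is positive semidefinite (any sign tables). -/
theorem posSemidef_of_eq_sum_scatterS [PartialOrder R] [StarOrderedRing R] [Fintype n] (k : ℕ) (sz : ℕ → ℕ)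
    (lab pos : n → ℕ) (sgn : ℕ → n → R) (X : (b : ℕ) → Matrix (Fin (sz b)) (Fin (sz b)) R)
    (hX : ∀ b < k, (X b).PosSemidef) {M : Matrix n n R}
    (hM : ∀ i j, M i j = ∑ b ∈ Finset.range k, scatterS (sz b) lab pos (sgn b) b (X b) i j) :
    M.PosSemidef := by
  have hM' : M = ∑ b ∈ Finset.range k, scatterS (sz b) lab pos (sgn b) b (X b) := by
    ext i j; rw [hM, Matrix.sum_apply]
  rw [hM']
  exact posSemidef_sum (x := fun b => scatterS (sz b) lab pos (sgn b) b (X b)) (Finset.range k)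
    fun b hb => posSemidef_scatterS _ _ _ _ _ (hX b (Finset.mem_range.1 hb))

end Signed

end BlockScatter

end Summit.Ventures.CertifiedQuantumChemistry
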